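import Summits.HodgeConjecture.HodgeConjecture.Theorems.Q8BireflectionGroupDensityKatzFree
import Summits.HodgeConjecture.HodgeConjecture.Theorems.Q8SymplecticPowersTransportRestrictionCurrency
import HarnessLib

/-!
# Route `Q8SymplecticPowers`, crux K1Q — BQ-CORE in the rational-ambient currency and the RESTRICTION CURRENCY of S7(c), WITHOUT Katz's
# recognition theorems (re-run of `Q8BireflectionGroupDensityAmbient` §2 and `Q8SymplecticPowersTransportRestrictionCurrency` on
# `Q8BireflectionGroupDensityKatzFree`)

Support file for crux K1Q (stmt-HodgeConjecture-24190; `--supports … --as helper`; nothing here closes an item). Prover seat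
`hodge-nonav-19716-p2` (g16). The two theorems below are the tree's
`Q8BireflectionGroupDensityAmbient.mem_glIdentityComponent_restrict_of_bireflection` (prover-Ax g17) and
`Q8SymplecticPowersTransportRestrictionCurrency.mem_glIdentityComponent_of_variablePart` (19716-p2 g14) with the binders
`(h14 : Katz1990_thm14_gabber_of_ne) (h14' : Katz1990_thm14_gabber_dim8) (h15 : Katz1990_thm15_pseudoreflection) (h141 : Katz1990_rmk141_nonsimple)`
DELETED and nothing else changed; the proofs are the verbatim ones, their single call into BQ-CORE redirected to the unconditional
`Q8BireflectionGroupDensityKatzFree.mem_glIdentityComponent_of_bireflection_baseChange'` (lemma BL = the tree theorem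
`Literature.Algebra.Lie.SymplecticBireflection.eq_skewAdjoint_of_isIrreducibleOn_of_conj_mem'`, lane `lit-hodgefound`). The §1 transport
lemmas of `Q8BireflectionGroupDensityAmbient` and the glue lemmas of `Q8SymplecticPowersTransportRestriction` are consumed by name.

* `mem_glIdentityComponent_restrict_of_bireflection` — BQ-CORE for the variable quaternionic part `W ≤ H` (hypotheses (h_sirr), (h_bi),
  `6 ≤ dim` in the S4 (iii) ∕ S5 shape on `W.baseChange ℂ ⊓ eigenspace (A.baseChange ℂ) i`; conclusion for the restriction `g_W`).
* `mem_glIdentityComponent_of_variablePart` — over `ℚ`, `Qf` symmetric non-degenerate, `A⁴ = 1`, `B² = A²`, `BA = A³B`, `N` the finite-orbit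
  span, `Mv = ker(A² + 1) ⊓ N^⊥`, (hV) `ker(A² − 1) ≤ N`, (hNQ), S4 (ii)(iii), S5 in point currency ⟹ every `g ∈ GL(H)` commuting with
  `A, B`, `Qf`-isometric, `g|_N = id` lies in `glIdentityComponent Γ`.

CONSEQUENCE: the S7⁺ telescope (`Q8SymplecticPowersStubTransportHeredityQ9`) re-run on `mem_glIdentityComponent_of_variablePart` of this
file needs no Katz antecedent (sibling file `Q8SymplecticPowersStubTransportHeredityQ14`): print packet S8 of the line «mechanism-v2»
drops Katz Thm 1.4 (both forms) and Rmk 1.4.1.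
HONEST FRAMING: algebra only; K1Q ∕ HC ∕ HC_AV NOT proved; item 24190 OPEN.

## References
* [SpringerLAG1998] T. A. Springer, *Linear Algebraic Groups*, 2nd ed. (1998), 2.2.1.
* [CarlsonMullerStachPeters2017] J. Carlson, S. Müller-Stach, C. Peters, *Period Mappings and Period Domains*, 2nd ed., Lemma–Def. 15.3.7.
* [Katz1990ESDE] N. M. Katz, *Exponential Sums and Differential Equations* (1990), Ch. 1 — Thms. 1.4–1.5, Rmk. 1.4.1 NOT used.
-/

noncomputable section

set_option linter.dupNamespace false

namespace Summit.HodgeConjecture.HodgeConjecture.Theorems.Q8BireflectionGroupDensityAmbientKatzFree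

open Module Literature.AlgebraicGeometry.Motives Literature.AlgebraicGeometry.HodgeTheory
open Literature.Algebra.Lie Literature.Algebra.Lie.KatzRecognition
open Summit.HodgeConjecture.HodgeConjecture.Theorems.Q8BireflectionGroupDensity
open Summit.HodgeConjecture.HodgeConjecture.Theorems.Q8BireflectionGroupDensityAmbient
  hiding mem_glIdentityComponent_restrict_of_bireflection
open Summit.HodgeConjecture.HodgeConjecture.Theorems.Q8SymplecticPowersTransportRestriction
open LinearMap (BilinForm)
open scoped TensorProduct

/-! ### §1 BQ-CORE in the rational-ambient currency (Katz-free) -/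

/-- **BQ-CORE for the variable quaternionic part `W ≤ H` (rational-ambient currency of stubs S4 (iii), S5 of «mechanism-v2»).**
`K → ℂ`; `H` finite-dimensional over `K` with a symmetric bilinear form `Q`; `A, B ∈ End_K H`; `W ≤ H` stable under `A, B`, on which
`A² = B² = −1`, `AB = −BA`, `A, B` are `Q`-isometries and `Q` is non-degenerate; `Γ ≤ GL_K(H)` preserving `W`, commuting with `A, B` on `W`
and `Q`-isometric on `W`; `i ∈ ℂ`, `i² = −1`, `M := W.baseChange ℂ ⊓ eigenspace (A.baseChange ℂ) i` of dimension `≥ 6`;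
(h_sirr) every finite-index `Γ' ≤ Γ` leaves invariant no subspace of `M` other than `⊥, M` (action through `γ.toLinearMap.baseChange ℂ`);
(h_bi) some `γ ∈ Γ` acts on `W.baseChange ℂ` as an `(i, −i)`-bireflection of `(M, Q_ℂ(·, B_ℂ ·))`. Let `Γ_W ≤ GL_K(W)` be the group of
restrictions of `Γ` (`η ∈ Γ_W ↔ ∃ θ ∈ Γ, η = θ|_W`). Then for every `g ∈ GL_K(H)` commuting with `A, B` on `W` and `Q`-isometric on `W`,
every restriction `g_W ∈ GL_K(W)` of `g` lies in `glIdentityComponent Γ_W`. UNCONDITIONAL: the statement of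
`Q8BireflectionGroupDensityAmbient.mem_glIdentityComponent_restrict_of_bireflection` with the four Katz binders deleted, its proof verbatim
over `Q8BireflectionGroupDensityKatzFree.mem_glIdentityComponent_of_bireflection_baseChange'`. K1Q ∕ HC are NOT proved here.
[cite: SpringerLAG1998, 2.2.1] -/
theorem mem_glIdentityComponent_restrict_of_bireflection
    {K : Type} [Field K] [Algebra K ℂ] {H : Type} [AddCommGroup H] [Module K H] [FiniteDimensional K H]
    {Q : BilinForm K H} (hQs : ∀ x y, Q x y = Q y x) {A B : H →ₗ[K] H} (W : Submodule K H)
    (hAW : ∀ x ∈ W, A x ∈ W) (hBW : ∀ x ∈ W, B x ∈ W) (hQW : ∀ x ∈ W, (∀ y ∈ W, Q x y = 0) → x = 0)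
    (haa : ∀ x ∈ W, A (A x) = -x) (hbb : ∀ x ∈ W, B (B x) = -x) (hab : ∀ x ∈ W, A (B x) = -B (A x))
    (haQ : ∀ x ∈ W, ∀ y ∈ W, Q (A x) (A y) = Q x y) (hQb : ∀ x ∈ W, ∀ y ∈ W, Q (B x) (B y) = Q x y) {i : ℂ} (hi : i * i = -1)
    (hM : 6 ≤ finrank ℂ ↥(W.baseChange ℂ ⊓ Module.End.eigenspace (A.baseChange ℂ) i))
    {Γ : Subgroup (H ≃ₗ[K] H)} (hΓW : ∀ γ ∈ Γ, ∀ x ∈ W, γ x ∈ W) (hΓa : ∀ γ ∈ Γ, ∀ x ∈ W, γ (A x) = A (γ x))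
    (hΓb : ∀ γ ∈ Γ, ∀ x ∈ W, γ (B x) = B (γ x)) (hΓQ : ∀ γ ∈ Γ, ∀ x ∈ W, ∀ y ∈ W, Q (γ x) (γ y) = Q x y)
    (h_sirr : ∀ Γ' : Subgroup (H ≃ₗ[K] H), Γ' ≤ Γ → (Γ'.subgroupOf Γ).FiniteIndex →
      ∀ F : Submodule ℂ (ℂ ⊗[K] H), F ≤ W.baseChange ℂ ⊓ Module.End.eigenspace (A.baseChange ℂ) i →
      (∀ γ ∈ Γ', ∀ x ∈ F, (γ.toLinearMap.baseChange ℂ) x ∈ F) → F = ⊥ ∨ F = W.baseChange ℂ ⊓ Module.End.eigenspace (A.baseChange ℂ) i)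
    (h_bi : ∃ γ ∈ Γ, ∃ ℓp ℓm : ℂ ⊗[K] H, ℓp ∈ W.baseChange ℂ ∧ ℓm ∈ W.baseChange ℂ ∧ A.baseChange ℂ ℓp = i • ℓp ∧
      A.baseChange ℂ ℓm = i • ℓm ∧ (Q.baseChange ℂ) ℓp (B.baseChange ℂ ℓm) ≠ 0 ∧ (γ.toLinearMap.baseChange ℂ) ℓp = i • ℓp ∧
      (γ.toLinearMap.baseChange ℂ) ℓm = (-i) • ℓm ∧ ∀ x ∈ W.baseChange ℂ, A.baseChange ℂ x = i • x →
        (Q.baseChange ℂ) x (B.baseChange ℂ ℓp) = 0 → (Q.baseChange ℂ) x (B.baseChange ℂ ℓm) = 0 → (γ.toLinearMap.baseChange ℂ) x = x)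
    {ΓW : Subgroup (W ≃ₗ[K] W)} (hΓW' : ∀ η : W ≃ₗ[K] W, η ∈ ΓW ↔ ∃ θ ∈ Γ, ∀ x : W, ((η x : W) : H) = θ x)
    {g : H ≃ₗ[K] H} (hga : ∀ x ∈ W, g (A x) = A (g x)) (hgb : ∀ x ∈ W, g (B x) = B (g x))
    (hgQ : ∀ x ∈ W, ∀ y ∈ W, Q (g x) (g y) = Q x y) {gW : W ≃ₗ[K] W} (hgW : ∀ x : W, ((gW x : W) : H) = g x) :
    gW ∈ glIdentityComponent ΓW := by
  classical
  -- the restricted data on `V := W`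
  set φ := W.subtype.baseChange ℂ with hφdef
  have hφ : Function.Injective φ := subtype_baseChange_injective W
  set a : W →ₗ[K] W := A.restrict hAW with ha
  set b : W →ₗ[K] W := B.restrict hBW with hb
  set QW : BilinForm K W := Q.compl₁₂ W.subtype W.subtype with hQW'
  have hQWapp : ∀ x y : W, QW x y = Q (x : H) (y : H) := fun x y => rfl
  have hnatA : ∀ y, φ (a.baseChange ℂ y) = A.baseChange ℂ (φ y) := subtype_baseChange_comm W (η := a) (f := A) fun x => rfl
  have hnatB : ∀ y, φ (b.baseChange ℂ y) = B.baseChange ℂ (φ y) := subtype_baseChange_comm W (η := b) (f := B) fun x => rfl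
  have hform : ∀ y y', QW.baseChange ℂ y y' = Q.baseChange ℂ (φ y) (φ y') := baseChange_compl₁₂_subtype W Q
  have heig : ∀ y, a.baseChange ℂ y = i • y ↔ A.baseChange ℂ (φ y) = i • φ y := restrict_baseChange_eq_smul_iff W hAW i
  have hMap : (Module.End.eigenspace (a.baseChange ℂ) i).map φ = W.baseChange ℂ ⊓ Module.End.eigenspace (A.baseChange ℂ) i :=
    map_eigenspace_restrict_eq W hAW i
  -- §A the quaternionic data on `W`
  have hQs' : ∀ x y : W, QW x y = QW y x := fun x y => hQs x y
  have hQn' : QW.Nondegenerate := by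
    refine ⟨fun x hx => Subtype.ext (hQW x x.2 fun y hy => hx ⟨y, hy⟩), fun y hy => Subtype.ext (hQW y y.2 fun x hx => ?_)⟩
    rw [hQs]; exact hy ⟨x, hx⟩
  have haa' : ∀ x : W, a (a x) = -x := fun x => Subtype.ext (haa x x.2)
  have hbb' : ∀ x : W, b (b x) = -x := fun x => Subtype.ext (hbb x x.2)
  have hab' : ∀ x : W, a (b x) = -b (a x) := fun x => Subtype.ext (hab x x.2)
  have haQ' : ∀ x y : W, QW (a x) (a y) = QW x y := fun x y => haQ x x.2 y y.2
  have hQb' : ∀ x y : W, QW (b x) (b y) = QW x y := fun x y => hQb x x.2 y y.2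
  have hM' : 6 ≤ finrank ℂ (Module.End.eigenspace (a.baseChange ℂ) i) := by
    rw [LinearEquiv.finrank_eq (Submodule.equivMapOfInjective φ hφ (Module.End.eigenspace (a.baseChange ℂ) i)), hMap]
    exact hM
  -- §B the restricted group `Γ_W`
  have hΓa' : ∀ η ∈ ΓW, ∀ x, η (a x) = a (η x) := fun η hη x => by
    obtain ⟨θ, hθ, hηθ⟩ := (hΓW' η).1 hη
    exact Subtype.ext (by rw [hηθ]; change θ (A x) = A (η x : H); rw [hΓa θ hθ x x.2, ← hηθ])
  have hΓb' : ∀ η ∈ ΓW, ∀ x, η (b x) = b (η x) := fun η hη x => by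
    obtain ⟨θ, hθ, hηθ⟩ := (hΓW' η).1 hη
    exact Subtype.ext (by rw [hηθ]; change θ (B x) = B (η x : H); rw [hΓb θ hθ x x.2, ← hηθ])
  have hΓQ' : ∀ η ∈ ΓW, ∀ x y, QW (η x) (η y) = QW x y := fun η hη x y => by
    obtain ⟨θ, hθ, hηθ⟩ := (hΓW' η).1 hη
    rw [hQWapp, hQWapp, hηθ, hηθ]; exact hΓQ θ hθ x x.2 y y.2
  -- §C (h_sirr) on `V := W`, rational side
  have h_sirr' : ∀ Γ' : Subgroup (W ≃ₗ[K] W), Γ' ≤ ΓW → (Γ'.subgroupOf ΓW).FiniteIndex →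
      ∀ F : Submodule ℂ (ℂ ⊗[K] W), F ≤ Module.End.eigenspace (a.baseChange ℂ) i →
      (∀ γ ∈ Γ', ∀ x ∈ F, (γ : W →ₗ[K] W).baseChange ℂ x ∈ F) → F = ⊥ ∨ F = Module.End.eigenspace (a.baseChange ℂ) i := by
    intro Γq hΓq hfi F hFM hFst
    obtain ⟨Θ', hΘ'le, hΘ'fi, hΘ'res⟩ := exists_finiteIndex_restrict_of_finiteIndex W hΓW hΓW' (Δ := Γq) hfi
    have hFM' : F.map φ ≤ W.baseChange ℂ ⊓ Module.End.eigenspace (A.baseChange ℂ) i := by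
      rw [← hMap]; exact Submodule.map_mono hFM
    have hFst' : ∀ γ ∈ Θ', ∀ x ∈ F.map φ, (γ.toLinearMap.baseChange ℂ) x ∈ F.map φ := by
      rintro γ hγ _ ⟨y, hy, rfl⟩
      obtain ⟨η, hη, hηγ⟩ := hΘ'res γ hγ
      refine ⟨(η : W →ₗ[K] W).baseChange ℂ y, hFst η hη y hy, ?_⟩
      exact subtype_baseChange_comm W hηγ y
    rcases h_sirr Θ' hΘ'le hΘ'fi (F.map φ) hFM' hFst' with h0 | h1
    · left
      exact Submodule.map_injective_of_injective hφ (by rw [h0, Submodule.map_bot])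
    · right
      exact Submodule.map_injective_of_injective hφ (by rw [h1, hMap])
  -- §D (h_bi) on `V := W`
  have h_bi' : ∃ η ∈ ΓW, ∃ ℓp ℓm : ℂ ⊗[K] W, a.baseChange ℂ ℓp = i • ℓp ∧ a.baseChange ℂ ℓm = i • ℓm ∧
      QW.baseChange ℂ ℓp (b.baseChange ℂ ℓm) ≠ 0 ∧ (η : W →ₗ[K] W).baseChange ℂ ℓp = i • ℓp ∧
      (η : W →ₗ[K] W).baseChange ℂ ℓm = (-i) • ℓm ∧
      ∀ x, a.baseChange ℂ x = i • x → QW.baseChange ℂ x (b.baseChange ℂ ℓp) = 0 → QW.baseChange ℂ x (b.baseChange ℂ ℓm) = 0 →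
        (η : W →ₗ[K] W).baseChange ℂ x = x := by
    obtain ⟨γ, hγ, ℓp, ℓm, hℓp, hℓm, h1, h2, h3, h4, h5, h6⟩ := h_bi
    obtain ⟨yp, rfl⟩ := (mem_baseChange_iff_exists W).1 hℓp
    obtain ⟨ym, rfl⟩ := (mem_baseChange_iff_exists W).1 hℓm
    -- the restriction `η` of `γ` to `W`
    have hγW : ∀ x ∈ W, γ x ∈ W := hΓW γ hγ
    have hγW' : ∀ x ∈ W, γ.symm x ∈ W := fun x hx => hΓW γ⁻¹ (Γ.inv_mem hγ) x hx
    let η : W ≃ₗ[K] W := LinearEquiv.ofLinear ((γ : H →ₗ[K] H).restrict hγW) ((γ.symm : H →ₗ[K] H).restrict hγW')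
      (LinearMap.ext fun x => Subtype.ext (by simp)) (LinearMap.ext fun x => Subtype.ext (by simp))
    have hη : ∀ x : W, ((η x : W) : H) = γ x := fun x => rfl
    have hnatη : ∀ y, φ ((η : W →ₗ[K] W).baseChange ℂ y) = (γ.toLinearMap.baseChange ℂ) (φ y) :=
      subtype_baseChange_comm W hη
    refine ⟨η, (hΓW' η).2 ⟨γ, hγ, hη⟩, yp, ym, (heig yp).2 h1, (heig ym).2 h2, ?_, ?_, ?_, ?_⟩
    · rw [hform, hnatB]; exact h3
    · exact hφ (by rw [hnatη, h4, map_smul])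
    · exact hφ (by rw [hnatη, h5, map_smul])
    · intro x hx hp hm
      apply hφ
      rw [hnatη]
      refine h6 (φ x) ((mem_baseChange_iff_exists W).2 ⟨x, rfl⟩) ((heig x).1 hx) ?_ ?_
      · rw [← hnatB, ← hform]; exact hp
      · rw [← hnatB, ← hform]; exact hm
  -- §E the element `g_W`
  have hga' : ∀ x, gW (a x) = a (gW x) := fun x =>
    Subtype.ext (by rw [hgW]; change g (A x) = A (gW x : H); rw [hga x x.2, ← hgW])
  have hgb' : ∀ x, gW (b x) = b (gW x) := fun x =>
    Subtype.ext (by rw [hgW]; change g (B x) = B (gW x : H); rw [hgb x x.2, ← hgW])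
  have hgQ' : ∀ x y, QW (gW x) (gW y) = QW x y := fun x y => by
    rw [hQWapp, hQWapp, hgW, hgW]; exact hgQ x x.2 y y.2
  exact Q8BireflectionGroupDensityKatzFree.mem_glIdentityComponent_of_bireflection_baseChange' hQs' hQn' haa' hbb' hab' haQ' hQb' hi
    hM' hΓa' hΓb' hΓQ' h_sirr' h_bi' hga' hgb' hgQ'


/-! ### §2 The restriction currency of S7(c) (Katz-free) -/

set_option maxHeartbeats 400000 in
/-- **RESTRICTION CURRENCY of S7(c) (BQ-CORE on `Mv = N^⊥` returns to `H²`).** See the module docstring: over `ℚ`, with `Qf` symmetric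
non-degenerate, `A⁴ = 1`, `B² = A²`, `BA = A³B`, `A, B` `Qf`-isometries, `Γ` commuting with `A, B` inside `O(Qf)`, `N` the finite-orbit
span (registered text), `Mv = ker(A²+1) ⊓ N^⊥` (registered text), hypotheses (hV) `ker(A²−1) ≤ N`, (hNQ) `Qf|_N` non-degenerate,
S4 (ii)(iii) and S5 VERBATIM in point currency, and NO named fact: every `g ∈ GL(H)` commuting with `A, B`, `Qf`-isometric, equal to
the identity on `N`, lies in `glIdentityComponent Γ` — the statement of
`Q8SymplecticPowersTransportRestrictionCurrency.mem_glIdentityComponent_of_variablePart` with the four Katz binders deleted, proof verbatim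
over `mem_glIdentityComponent_restrict_of_bireflection` of this file. [cite: SpringerLAG1998, 2.2.1]
[cite: CarlsonMullerStachPeters2017, Lemma–Def. 15.3.7] -/
theorem mem_glIdentityComponent_of_variablePart
    {H : Type} [AddCommGroup H] [Module ℚ H] [FiniteDimensional ℚ H]
    {Qf : BilinForm ℚ H} (hQs : ∀ x y, Qf x y = Qf y x) (hQn : Qf.Nondegenerate)
    {A B : H →ₗ[ℚ] H} (hA4 : A ^ 4 = 1) (hB2 : B ^ 2 = A ^ 2) (hBA : B * A = A ^ 3 * B)
    (hAQ : ∀ x y, Qf (A x) (A y) = Qf x y) (hBQ : ∀ x y, Qf (B x) (B y) = Qf x y)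
    {Γ : Subgroup (H ≃ₗ[ℚ] H)} (hΓA : ∀ γ ∈ Γ, ∀ x, γ (A x) = A (γ x)) (hΓB : ∀ γ ∈ Γ, ∀ x, γ (B x) = B (γ x))
    (hΓQ : ∀ γ ∈ Γ, ∀ x y, Qf (γ x) (γ y) = Qf x y)
    {N : Submodule ℚ H}
    (hN : N = Submodule.span ℚ {x : H | ∃ Γ' : Subgroup (H ≃ₗ[ℚ] H), Γ' ≤ Γ ∧ (Γ'.subgroupOf Γ).FiniteIndex ∧
      ∀ γ ∈ Γ', γ x = x})
    (hV : Module.End.eigenspace (A ^ 2) 1 ≤ N) (hNQ : ∀ x ∈ N, (∀ y ∈ N, Qf x y = 0) → x = 0)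
    {Mv : Submodule ℚ H} (hMv : Mv = Module.End.eigenspace (A ^ 2) (-1) ⊓ Qf.orthogonal N)
    (hM : 6 ≤ finrank ℂ ↥(Mv.baseChange ℂ ⊓ Module.End.eigenspace (A.baseChange ℂ) Complex.I))
    (h_sirr : ∀ Γ' : Subgroup (H ≃ₗ[ℚ] H), Γ' ≤ Γ → (Γ'.subgroupOf Γ).FiniteIndex →
      ∀ F : Submodule ℂ (ℂ ⊗[ℚ] H), F ≤ Mv.baseChange ℂ ⊓ Module.End.eigenspace (A.baseChange ℂ) Complex.I →
      (∀ γ ∈ Γ', ∀ x ∈ F, (γ.toLinearMap.baseChange ℂ) x ∈ F) →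
      F = ⊥ ∨ F = Mv.baseChange ℂ ⊓ Module.End.eigenspace (A.baseChange ℂ) Complex.I)
    (h_bi : ∃ γ ∈ Γ, ∃ ℓp ℓm : ℂ ⊗[ℚ] H, ℓp ∈ Mv.baseChange ℂ ∧ ℓm ∈ Mv.baseChange ℂ ∧
      A.baseChange ℂ ℓp = Complex.I • ℓp ∧ A.baseChange ℂ ℓm = Complex.I • ℓm ∧
      (Qf.baseChange ℂ) ℓp (B.baseChange ℂ ℓm) ≠ 0 ∧ (γ.toLinearMap.baseChange ℂ) ℓp = Complex.I • ℓp ∧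
      (γ.toLinearMap.baseChange ℂ) ℓm = (-Complex.I) • ℓm ∧
      ∀ x ∈ Mv.baseChange ℂ, A.baseChange ℂ x = Complex.I • x → (Qf.baseChange ℂ) x (B.baseChange ℂ ℓp) = 0 →
        (Qf.baseChange ℂ) x (B.baseChange ℂ ℓm) = 0 → (γ.toLinearMap.baseChange ℂ) x = x)
    {g : H ≃ₗ[ℚ] H} (hgA : ∀ x, g (A x) = A (g x)) (hgB : ∀ x, g (B x) = B (g x))
    (hgQ : ∀ x y, Qf (g x) (g y) = Qf x y) (hgN : ∀ x ∈ N, g x = x) :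
    g ∈ glIdentityComponent Γ := by
  classical
  -- ### §0 identities in `End H`
  have hA2sq : A ^ 2 * A ^ 2 = 1 := by rw [← pow_add]; exact hA4
  have hB4 : B ^ 4 = 1 := by
    calc B ^ 4 = B ^ 2 * B ^ 2 := by rw [← pow_add]
      _ = 1 := by rw [hB2, hA2sq]
  have hBA2 : B * A ^ 2 = A ^ 2 * B := by
    calc B * A ^ 2 = B * A * A := by rw [pow_two, mul_assoc]
      _ = A ^ 3 * B * A := by rw [hBA]
      _ = A ^ 3 * (B * A) := by rw [mul_assoc]
      _ = A ^ 3 * (A ^ 3 * B) := by rw [hBA]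
      _ = A ^ 6 * B := by rw [← mul_assoc, ← pow_add]
      _ = A ^ 2 * B := by rw [show (6 : ℕ) = 2 + 4 from rfl, pow_add, hA4, mul_one]
  have hA2x : ∀ x, (A ^ 2) x = A (A x) := fun x => by rw [pow_two]; rfl
  have hB2x : ∀ x, (B ^ 2) x = B (B x) := fun x => by rw [pow_two]; rfl
  have hA2A : ∀ x, A ((A ^ 2) x) = (A ^ 2) (A x) := fun x => by
    change (A * A ^ 2) x = (A ^ 2 * A) x; rw [← pow_succ', ← pow_succ]
  have hA2B : ∀ x, B ((A ^ 2) x) = (A ^ 2) (B x) := fun x => by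
    change (B * A ^ 2) x = (A ^ 2 * B) x; rw [hBA2]
  have hA2Γ : ∀ γ ∈ Γ, ∀ x, γ ((A ^ 2) x) = (A ^ 2) (γ x) := fun γ hγ x => by
    rw [hA2x, hA2x, hΓA γ hγ, hΓA γ hγ]
  have hA2g : ∀ x, g ((A ^ 2) x) = (A ^ 2) (g x) := fun x => by rw [hA2x, hA2x, hgA, hgA]
  have hA2Q : ∀ x y, Qf ((A ^ 2) x) ((A ^ 2) y) = Qf x y := fun x y => by rw [hA2x, hA2x, hAQ, hAQ]
  -- `A`, `A²`, `B` as automorphisms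
  obtain ⟨Ae, hAe, hAe'⟩ := exists_linearEquiv_of_mul_eq_one (f := A) (g := A ^ 3)
    (by rw [← pow_succ']; exact hA4) (by rw [← pow_succ]; exact hA4)
  obtain ⟨A2e, hA2e, hA2e'⟩ := exists_linearEquiv_of_mul_eq_one (f := A ^ 2) (g := A ^ 2) hA2sq hA2sq
  obtain ⟨Be, hBe, hBe'⟩ := exists_linearEquiv_of_mul_eq_one (f := B) (g := B ^ 3)
    (by rw [← pow_succ']; exact hB4) (by rw [← pow_succ]; exact hB4)
  -- ### §1 `N = Fix(Γ₀)`; stability of `N`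
  obtain ⟨Γ₀, hΓ₀le, hΓ₀fi, -, hΓ₀fix⟩ := exists_finiteIndex_normal_span_fixed_iff Γ
  have hNfix : ∀ x, x ∈ N ↔ ∀ γ ∈ Γ₀, γ x = x := fun x => by rw [hN]; exact hΓ₀fix x
  have hΓN : ∀ γ ∈ Γ, ∀ x ∈ N, γ x ∈ N := fun γ hγ x hx => by
    rw [hN] at hx ⊢; exact span_fixed_map_mem Γ hγ hx
  have hAN : ∀ x ∈ N, A x ∈ N := fun x hx => by
    rw [hN] at hx ⊢; exact span_fixed_map_mem_of_comm Γ hΓA hx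
  have hBN : ∀ x ∈ N, B x ∈ N := fun x hx => by
    rw [hN] at hx ⊢; exact span_fixed_map_mem_of_comm Γ hΓB hx
  have hApowN : ∀ (k : ℕ), ∀ x ∈ N, (A ^ k) x ∈ N := by
    intro k
    induction k with
    | zero => intro x hx; simpa using hx
    | succ k ih => intro x hx; rw [pow_succ', Module.End.mul_apply]; exact hAN _ (ih x hx)
  have hBpowN : ∀ (k : ℕ), ∀ x ∈ N, (B ^ k) x ∈ N := by
    intro k
    induction k with
    | zero => intro x hx; simpa using hx
    | succ k ih => intro x hx; rw [pow_succ', Module.End.mul_apply]; exact hBN _ (ih x hx)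
  have hgsymmN : ∀ x ∈ N, g.symm x ∈ N := fun x hx => by
    have h := hgN x hx
    rw [← h, LinearEquiv.symm_apply_apply]; exact hx
  -- ### §2 `N^⊥` and its stability
  have hΓNp : ∀ γ ∈ Γ, ∀ x ∈ Qf.orthogonal N, γ x ∈ Qf.orthogonal N := fun γ hγ x hx =>
    orthogonal_map_mem_of_isometry (hΓQ γ hγ) (fun y hy => hΓN γ⁻¹ (Γ.inv_mem hγ) y hy) hx
  have hANp : ∀ x ∈ Qf.orthogonal N, A x ∈ Qf.orthogonal N := fun x hx => by
    have h := orthogonal_map_mem_of_isometry (γ := Ae) (fun x y => by rw [hAe, hAe]; exact hAQ x y)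
      (fun y hy => by rw [hAe']; exact hApowN 3 y hy) hx
    rwa [hAe] at h
  have hA2Np : ∀ x ∈ Qf.orthogonal N, (A ^ 2) x ∈ Qf.orthogonal N := fun x hx =>
    by rw [hA2x]; exact hANp _ (hANp x hx)
  have hBNp : ∀ x ∈ Qf.orthogonal N, B x ∈ Qf.orthogonal N := fun x hx => by
    have h := orthogonal_map_mem_of_isometry (γ := Be) (fun x y => by rw [hBe, hBe]; exact hBQ x y)
      (fun y hy => by rw [hBe']; exact hBpowN 3 y hy) hx
    rwa [hBe] at h
  have hgNp : ∀ x ∈ Qf.orthogonal N, g x ∈ Qf.orthogonal N := fun x hx =>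
    orthogonal_map_mem_of_isometry hgQ hgsymmN hx
  -- `N ∩ N^⊥ = 0`
  have hNNp : ∀ x ∈ N, x ∈ Qf.orthogonal N → x = 0 := fun x hxN hxNp =>
    hNQ x hxN fun y hy => by
      rw [LinearMap.BilinForm.mem_orthogonal_iff] at hxNp
      rw [hQs]; exact hxNp y hy
  -- ### §3 `N^⊥ = Mv`, `H = N ⊕ Mv`, `Qf|_{Mv}` non-degenerate
  have hMv_V : ∀ x ∈ Mv, (A ^ 2) x = -x := fun x hx => by
    rw [hMv] at hx
    have h := Module.End.mem_eigenspace_iff.1 hx.1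
    rwa [neg_one_smul] at h
  have hMv_Np : ∀ x ∈ Mv, x ∈ Qf.orthogonal N := fun x hx => by rw [hMv] at hx; exact hx.2
  have hNp_Mv : ∀ x ∈ Qf.orthogonal N, x ∈ Mv := fun x hx => by
    rw [hMv]
    refine Submodule.mem_inf.2 ⟨?_, hx⟩
    have hy : x + (A ^ 2) x ∈ Module.End.eigenspace (A ^ 2) 1 := by
      rw [Module.End.mem_eigenspace_iff, one_smul, map_add, ← Module.End.mul_apply, hA2sq, Module.End.one_apply,
        add_comm]
    have hy0 : x + (A ^ 2) x = 0 := hNNp _ (hV hy) ((Qf.orthogonal N).add_mem hx (hA2Np x hx))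
    rw [Module.End.mem_eigenspace_iff, neg_one_smul]
    exact eq_neg_of_add_eq_zero_right hy0
  have hNp_eq : Qf.orthogonal N = Mv := le_antisymm hNp_Mv hMv_Np
  have hrefl : Qf.IsRefl := fun x y h => by rw [hQs]; exact h
  have hres : (Qf.restrict N).Nondegenerate := by
    refine ⟨fun x hx => Subtype.ext (hNQ x x.2 fun y hy => hx ⟨y, hy⟩), fun y hy => Subtype.ext (hNQ y y.2 fun x hx => ?_)⟩
    rw [hQs]; exact hy ⟨x, hx⟩
  have hcompl : IsCompl N Mv := by
    rw [← hNp_eq]; exact LinearMap.BilinForm.isCompl_orthogonal_of_restrict_nondegenerate hrefl hres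
  have hQW : ∀ x ∈ Mv, (∀ y ∈ Mv, Qf x y = 0) → x = 0 := by
    intro x hx h
    refine hQn.1 x fun y => ?_
    have hy : y ∈ N ⊔ Mv := by rw [hcompl.sup_eq_top]; exact Submodule.mem_top
    obtain ⟨n, hn, m, hm, rfl⟩ := Submodule.mem_sup.1 hy
    have h1 : Qf x n = 0 := by
      rw [hQs]; exact (LinearMap.BilinForm.mem_orthogonal_iff.1 (hMv_Np x hx)) n hn
    rw [map_add, h1, h m hm, zero_add]
  -- ### §4 the quaternionic data on `Mv`
  have hAMv : ∀ x ∈ Mv, A x ∈ Mv := fun x hx => by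
    rw [hMv] at hx ⊢
    exact ⟨apply_mem_eigenspace_of_comm (f := A ^ 2) (g := A) hA2A hx.1, hANp x hx.2⟩
  have hBMv : ∀ x ∈ Mv, B x ∈ Mv := fun x hx => by
    rw [hMv] at hx ⊢
    exact ⟨apply_mem_eigenspace_of_comm (f := A ^ 2) (g := B) hA2B hx.1, hBNp x hx.2⟩
  have hΓMv : ∀ γ ∈ Γ, ∀ x ∈ Mv, γ x ∈ Mv := fun γ hγ x hx => by
    rw [hMv] at hx ⊢
    exact ⟨apply_mem_eigenspace_of_comm (f := A ^ 2) (g := (γ : H →ₗ[ℚ] H)) (hA2Γ γ hγ) hx.1, hΓNp γ hγ x hx.2⟩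
  have hgMv : ∀ x ∈ Mv, g x ∈ Mv := fun x hx => by
    rw [hMv] at hx ⊢
    exact ⟨apply_mem_eigenspace_of_comm (f := A ^ 2) (g := (g : H →ₗ[ℚ] H)) hA2g hx.1, hgNp x hx.2⟩
  have hgMv' : ∀ x ∈ Mv, g.symm x ∈ Mv := fun x hx => by
    -- `g.symm` commutes with `A²`, is `Qf`-isometric and `g` preserves `N`
    have hA2g' : ∀ x, g.symm ((A ^ 2) x) = (A ^ 2) (g.symm x) := fun x =>
      g.injective (by rw [LinearEquiv.apply_symm_apply, hA2g, LinearEquiv.apply_symm_apply])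
    have hgQ' : ∀ x y, Qf (g.symm x) (g.symm y) = Qf x y := fun x y => by
      conv_rhs => rw [← g.apply_symm_apply x, ← g.apply_symm_apply y]
      exact (hgQ _ _).symm
    rw [hMv] at hx ⊢
    refine ⟨apply_mem_eigenspace_of_comm (f := A ^ 2) (g := (g.symm : H →ₗ[ℚ] H)) hA2g' hx.1,
      orthogonal_map_mem_of_isometry (γ := g.symm) hgQ' (fun y hy => ?_) hx.2⟩
    rw [LinearEquiv.symm_symm, hgN y hy]; exact hy
  have haa : ∀ x ∈ Mv, A (A x) = -x := fun x hx => by rw [← hA2x]; exact hMv_V x hx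
  have hbb : ∀ x ∈ Mv, B (B x) = -x := fun x hx => by rw [← hB2x, hB2]; exact hMv_V x hx
  have hab : ∀ x ∈ Mv, A (B x) = -B (A x) := fun x hx => by
    have h : B (A x) = -A (B x) := by
      change (B * A) x = -A (B x)
      rw [hBA, pow_succ', Module.End.mul_apply, Module.End.mul_apply, hMv_V _ (hBMv x hx), map_neg]
    rw [h, neg_neg]
  -- ### §5 restriction groups, the restricted `g`, BQ-CORE on `Mv`
  obtain ⟨ΓW, hΓW'⟩ := exists_restrictSubgroup hΓMv
  let gW : Mv ≃ₗ[ℚ] Mv := LinearEquiv.ofLinear ((g : H →ₗ[ℚ] H).restrict hgMv) ((g.symm : H →ₗ[ℚ] H).restrict hgMv')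
    (LinearMap.ext fun x => Subtype.ext (by simp)) (LinearMap.ext fun x => Subtype.ext (by simp))
  have hgW : ∀ x : Mv, ((gW x : Mv) : H) = g x := fun x => rfl
  have hgW_mem : gW ∈ glIdentityComponent ΓW :=
    mem_glIdentityComponent_restrict_of_bireflection hQs Mv hAMv hBMv hQW haa hbb hab
      (fun x _ y _ => hAQ x y) (fun x _ y _ => hBQ x y) Complex.I_mul_I hM hΓMv (fun γ hγ x _ => hΓA γ hγ x)
      (fun γ hγ x _ => hΓB γ hγ x) (fun γ hγ x _ y _ => hΓQ γ hγ x y) h_sirr h_bi hΓW' (fun x _ => hgA x)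
      (fun x _ => hgB x) (fun x _ y _ => hgQ x y) hgW
  -- finite-index descent to `Γ₀`
  obtain ⟨ΓW₀, hΓW₀'⟩ := exists_restrictSubgroup (Γ := Γ₀) (W := Mv) fun γ hγ => hΓMv γ (hΓ₀le hγ)
  obtain ⟨hle₀, hfi₀⟩ := le_and_finiteIndex_restrictSubgroup hΓ₀le hΓ₀fi hΓMv hΓW' hΓW₀'
  have hgW₀ : gW ∈ glIdentityComponent ΓW₀ :=
    Q8BireflectionGroupDensityAmbient.glIdentityComponent_subset_of_finiteIndex hle₀ hfi₀ hgW_mem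
  -- ### §6 back to `H = N ⊕ Mv`
  have hg₀ : g ∈ glIdentityComponent Γ₀ :=
    mem_glIdentityComponent_of_invariant_isCompl N Mv hcompl (Θ := Γ₀) (fun θ hθ x hx => (hNfix x).1 hx θ hθ)
      (fun θ hθ x hx => hΓMv θ (hΓ₀le hθ) x hx) hΓW₀' hgN (gQ := gW) hgW hgW₀
  exact glIdentityComponent_mono hΓ₀le hg₀

end Summit.HodgeConjecture.HodgeConjecture.Theorems.Q8BireflectionGroupDensityAmbientKatzFree

end
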